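import Summits.Ventures.PercRepro.ProfilePointedCircuitClassesSevenE
import Summits.Ventures.PercRepro.ProfilePointedCircuitClassesFiveTop

/-!
# PercRepro — THE CO-RANK-6 TOP THRESHOLD AT NULLITY `≤ 5` IS UNCONDITIONAL
(p5, gen 41; `proofs/P5-GM1.md` §61)

With `inOutBottomFour_holds` the nullity-5 chain of §53 loses its last hypothesis: Theorem A's step at the level
`5` on every matroid of nullity `5` and rank `≥ 7` (`biIndep_step_five_of_nullity_five`), and **the co-rank-6 top
threshold `(I_{ρ−1})` on every finite matroid with at most five more points than its rank, rank `≥ 6`**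
(`thresholdIneq_six_top_of_nullity_le_five`).
-/

open scoped Matroid

namespace PercRepro.Cogirth

open Finset ThmH Skew Shadow Profile

variable {α : Type} [DecidableEq α] {N : Matroid α} [N.Finite]

section SevenF

/-- **THEOREM A'S STEP AT THE LEVEL `5` ON EVERY MATROID OF NULLITY `5` AND RANK `≥ 7`**: `(n − 5)·P_5 ≤ 6·P_6`. -/
theorem biIndep_step_five_of_nullity_five (hn : (gr N).card = rk N (gr N) + 5) (hR : 7 ≤ rk N (gr N)) :
    ((gr N).card - 5) * (biIndepSets N 5).card ≤ 6 * (biIndepSets N 6).card :=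
  biIndep_step_five_of_nullity_five_of_inout inOutBottomFour_holds hn hR

/-- **THE CO-RANK-6 TOP THRESHOLD ON EVERY FINITE MATROID WITH AT MOST FIVE MORE POINTS THAN ITS RANK, RANK `≥ 6`**:
`ThresholdIneq N 6 (ρ(E) − 1)`, unconditional. -/
theorem thresholdIneq_six_top_of_nullity_le_five (hn : (gr N).card ≤ rk N (gr N) + 5)
    (hR : 6 ≤ rk N (gr N)) : ThresholdIneq N 6 (rk N (gr N) - 1) :=
  thresholdIneq_six_top_of_nullity_le_five_of_inout inOutBottomFour_holds hn hR

end SevenF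

end PercRepro.Cogirth
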